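import Literature.NumberTheory.EllipticCurves.Wuthrich2014.MainConjectureConverseProofs
import Literature.NumberTheory.EllipticCurves.Rank1Residual.Typed.X1
import Literature.NumberTheory.EllipticCurves.KellerYin2024.AnomalousRankZeroProofs
import HarnessLib

/-!
# Class X1 ∩ {r = 0}: the typed residual IS Mazur's main conjecture (kernel equivalence), and the
# per-pair main-conjecture certificates

HONEST FRAMING (BSD rank-≤1 residual cell `b2b-bsdres`, home `run/shared/lean/b2b/bsd-rank1-residual/`,
unit `b2b-bsdres-x1b`, prover B = the independent patchwork, no Keller–Yin input): the goal is to
DELETE the COMBINATION-SHAPED residual classes for ALL analytic-rank `≤ 1` curves over `ℚ` — "full BSD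
formula for every rank `≤ 1` curve in class C" assembled STRICTLY from published theorems — so that the
rank-`≤ 1` remainder becomes exactly the CONSTRUCTION-SHAPED classes, which are TYPED (missing-input
`Prop`s), NOT attempted; this is not "finishing BSD".

Theorems only. Class X1 = Eisenstein ANOMALOUS good `p` (`Rank1Residual.ClassX1`: `2 < p`, `E[p]`
reducible, good reduction at `p`, `a_p ≡ 1 (mod p)`, `¬(r = 0 ∧ gvpar)`). State of the class before
this file (REFEREE.md R7.2): rank `0` — one inequality `ord_p #Ш ≤ ord_p #Ш_an` class-wide in print
(Wuthrich 2014 Prop. 21; `padicValNat_shaOrder_le_of_classX1`), closed sub-class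
`p ∤ #Ш(E'/ℚ)_an` for some isogenous `E'` (`bsdp_of_classX1_of_L_one_ne_zero_of_isIsogenous`), typed
residual `Typed.X1.MissingInputAt W p` (prover B) = `MissingLowerBoundAt` in rank `0`, and typed
missing input `MazurMainConjecture W p` (prover A, `Summits/…/Theorems/Rank1ResidualX1Defs`), a
SUFFICIENT input by Castella–Grossi–Lee–Skinner's glue. This file adds, from
`Wuthrich2014/MainConjectureConverseProofs` (the converse of the chain: Wuthrich Thm. 16 + Greenberg
Thm. 4.1 + `h(0) ∈ ℤ_p^× ⇒ h ∈ Λ^×`):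

* `X1.mainConjecture_iff_bsdp`, `X1.mainConjecture_iff_missingInputAt` — at every X1 pair of analytic
  rank `0`, Mazur's main conjecture for `(E,p)` (Néron normalisation, every datum; literally the body
  of `MazurMainConjecture W p`) is EQUIVALENT to Miller's `BSD(E,p)` and to prover B's typed residual
  `Typed.X1.MissingInputAt W p`, granted the PUBLISHED named facts (Wuthrich Thm. 16, Greenberg
  Thm. 4.1, modularity, Gross–Zagier–Kolyvagin). So the residual sub-predicate of X1 ∩ {r = 0} is
  EXACTLY "Mazur's main conjecture at an anomalous Eisenstein prime, analytic rank `0`": necessary and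
  sufficient, one statement for both provers' typed inputs (REFEREE R6.6/R6.7: one vocabulary).
* `X1.forall_mainConjecture_iff_forall_bsdp` — the class-level form: the rank-`0` class statement
  "`∀ (E,p) ∈ X1`, `r_an = 0 ⇒ BSD(E,p)`" holds iff Mazur's main conjecture holds at every rank-`0`
  X1 pair.
* `X1.mainConjecture_of_shaAn_unit`, `X1.mainConjecture_of_isIsogenous_of_shaAn_unit` — PER-PAIR
  CERTIFICATES: Mazur's main conjecture for `(E,p)` at every rank-`0` X1 pair with `p ∤ #Ш(E/ℚ)_an`
  (Wuthrich Prop. 21), or with a `ℚ`-isogenous `E'` of the class with `p ∤ #Ш(E'/ℚ)_an` (+ Cassels).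
  On the census of the cell (conductor `< 10⁴`) this is ALL 300 rank-`0` X1 pairs (X1-B.md §2:
  298 directly, `2366d1@3`, `7154c1@3` through `2366d2`, `7154c2`), among them Greenberg's examples
  `11a1@5` (LNM 1716 §5: `Sel_{E}(ℚ_∞)_5 ≅ Λ^∧[5]`, `μ = 1`), `14a1@3`, `26b1@7` ("Conjecture 1.13
  would then be valid [if `μ = 0`]" — now unconditional): instances of Mazur's main conjecture at
  anomalous Eisenstein primes of type A, the case that Greenberg–Vatsal 2000 Thm. 1.3 and
  Castella–Grossi–Skinner 2025 Thm. A (LaTeXML v1 "Thm. 1") exclude, proved from the published record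
  per pair (lane
  pointer: the rank-`0` X1 census rows can carry "MC(E,p): THEOREM (Prop. 21 + converse chain)").

What this does NOT do: it proves no new pair of the class (the closed sub-class is unchanged) and
says nothing class-wide about rank `1` (where the cyclotomic main conjecture gives only the `p`-adic
BSD formula, `Wuthrich2014.padicBSD_inequality_of_charIdeal_dvd`).

References: [Wuthrich2014] Thm. 16, Prop. 21; [GreenbergLNM1716] Thm. 4.1, §5 (closing examples);
[CastellaEtAl2021] Thm. 5.1.4; [CastellaGrossiSkinner2025] (MC), Thm. A = Thm. 7.1.1 (LaTeXML v1
"Thm. 1"); [GreenbergVatsal2000]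
Thm. 1.3; [Miller2011LMS] Def. 1.1; [MilneADT2006] Thm. I.7.3.
-/

set_option autoImplicit false

noncomputable section

open scoped Classical MatrixGroups ModularForm

open CongruenceSubgroup WeierstrassCurve Literature.NumberTheory.EllipticCurves
  Literature.NumberTheory.EllipticCurves.ModularForms
  Literature.NumberTheory.EllipticCurves.Wuthrich2014
  Literature.NumberTheory.EllipticCurves.Rank1Residual.Typed

namespace Literature.NumberTheory.EllipticCurves.Rank1Residual

/-- From modularity with an integral Manin constant (`hmod`): `ord_{s=1} L(E,s) = 0 ⇒ L(E,1) ≠ 0`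
(the newform gives the entire continuation, `IsNewformOf.hasEntireLFunction`; then
`analyticRank_eq_zero_iff_holds`). Bookkeeping. [cite: BCDTJAMS2001, Theorem A] -/
theorem entireLFunction_one_ne_zero_of_analyticRank_eq_zero (hmod : nonempty_modularParametrizationData)
    (W : WeierstrassCurve ℚ) [W.IsElliptic] [W.IsGloballyMinimal] (hr0 : W.analyticRank = 0) :
    W.entireLFunction 1 ≠ 0 := by
  haveI : NeZero (W.conductorNorm ℤ) := ⟨(W.conductorNorm_pos_holds).ne'⟩
  obtain ⟨Dm⟩ := hmod W
  exact (W.analyticRank_eq_zero_iff_holds Dm.isNewformOf.hasEntireLFunction).mp hr0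

/-- **X1 ∩ {r = 0}: Mazur's main conjecture for `(E,p)` ⟺ Miller's `BSD(E,p)`.** For `W/ℚ` globally
minimal elliptic, `p` prime with `ClassX1 W p` and `ord_{s=1} L(E,s) = 0`, granted the PUBLISHED
named facts Wuthrich 2014 Thm. 16 (`hW16`), Greenberg 1999 Thm. 4.1 (`hGr`), modularity with an
integral Manin constant (`hmod`) and Gross–Zagier–Kolyvagin (`hGZK`): Mazur's cyclotomic main
conjecture for `(E,p)` in the Néron normalisation (for the cyclotomic `κ, γ`, every newform `f` of
`E` at level `N_E`, every `ϖ` with `ϖ · Ω_E = Ω⁺_f`, every dual datum `D`: `X` torsion and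
`char_Λ X = (g)`, `ι g = ϖ · L_p(f, α)` — literally the body of prover A's typed input
`MazurMainConjecture W p`) holds if and only if `BSDp W p`. (⇐ is the converse chain
`mainConjecture_of_bsdp`; ⇒ is Castella–Grossi–Lee–Skinner's glue.) The class X1 ∩ {r = 0} is of
parity type A (`¬ gvpar` by the class clause), where no published theorem gives either side.
[cite: GreenbergLNM1716, Thm. 4.1 and §5 (closing examples)] [cite: Wuthrich2014, Thm. 16 (p. 393)]
[cite: CastellaEtAl2021, Thm. 5.1.4 (proof)] -/
theorem X1.mainConjecture_iff_bsdp (hW16 : charIdeal_dvd_padicLFunction)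
    (hGr : greenberg_charValue_rankZero) (hmod : nonempty_modularParametrizationData)
    (hGZK : rank_eq_analyticRank_of_analyticRank_le_one)
    (W : WeierstrassCurve ℚ) [W.IsElliptic] [W.IsGloballyMinimal] (p : ℕ) [Fact p.Prime]
    (hX1 : ClassX1 W p) (hr0 : W.analyticRank = 0) :
    (∀ (κ : ZpExtension ℚ p) (γ : Field.absoluteGaloisGroup ℚ),
        κ.IsCyclotomic → κ.IsTopGenerator γ → IsCyclotomicVariable p γ →
      ∀ [NeZero (W.conductorNorm ℤ)] (f : CuspForm (Gamma0 (W.conductorNorm ℤ)) 2),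
        IsNewformOf W f → ∀ (ϖ : ℚ), (ϖ : ℝ) * W.realPeriodRat = plusPeriod f →
      ∀ (D : W.SelmerDualData κ γ), D.IsTorsion ∧
        ∃ g : IwasawaAlgebra p, D.charIdeal = Ideal.span {g} ∧
          iwasawaToPowerSeries p g =
            PowerSeries.C (ϖ : ℚ_[p]) * padicLFunction f (unitRoot W p : ℚ_[p])) ↔
    BSDp W p := by
  have hX := isClassX1_of_classX1 hX1
  exact Wuthrich2014.mainConjecture_iff_bsdp hW16 hGr hmod hGZK W p hX.two_ne
    hX.hasGoodReductionAtPrime hX.not_dvd_frobeniusTrace hX.not_hasIrreducibleModPGaloisRep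
    (entireLFunction_one_ne_zero_of_analyticRank_eq_zero hmod W hr0)

/-- **X1 ∩ {r = 0}: prover A's typed missing input ⟺ prover B's typed residual.** At an X1 pair of
analytic rank `0`, Mazur's main conjecture for `(E,p)` (body of `MazurMainConjecture W p`) holds iff
`Typed.X1.MissingInputAt W p` (whose rank-`0` clause is `MissingLowerBoundAt W p`:
`ord_p #Ш_an ≤ ord_p #Ш`; the rank-`1` clause is vacuous here). Same published facts as
`X1.mainConjecture_iff_bsdp`. [cite: GreenbergLNM1716, Thm. 4.1 and §5 (closing examples)]
[cite: Wuthrich2014, Thm. 16 (p. 393)] -/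
theorem X1.mainConjecture_iff_missingInputAt (hW16 : charIdeal_dvd_padicLFunction)
    (hGr : greenberg_charValue_rankZero) (hmod : nonempty_modularParametrizationData)
    (hGZK : rank_eq_analyticRank_of_analyticRank_le_one)
    (W : WeierstrassCurve ℚ) [W.IsElliptic] [W.IsGloballyMinimal] (p : ℕ) [Fact p.Prime]
    (hX1 : ClassX1 W p) (hr0 : W.analyticRank = 0) :
    (∀ (κ : ZpExtension ℚ p) (γ : Field.absoluteGaloisGroup ℚ),
        κ.IsCyclotomic → κ.IsTopGenerator γ → IsCyclotomicVariable p γ →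
      ∀ [NeZero (W.conductorNorm ℤ)] (f : CuspForm (Gamma0 (W.conductorNorm ℤ)) 2),
        IsNewformOf W f → ∀ (ϖ : ℚ), (ϖ : ℝ) * W.realPeriodRat = plusPeriod f →
      ∀ (D : W.SelmerDualData κ γ), D.IsTorsion ∧
        ∃ g : IwasawaAlgebra p, D.charIdeal = Ideal.span {g} ∧
          iwasawaToPowerSeries p g =
            PowerSeries.C (ϖ : ℚ_[p]) * padicLFunction f (unitRoot W p : ℚ_[p])) ↔
    X1.MissingInputAt W p := by
  have hX := isClassX1_of_classX1 hX1
  have hL : W.entireLFunction 1 ≠ 0 := entireLFunction_one_ne_zero_of_analyticRank_eq_zero hmod W hr0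
  rw [Wuthrich2014.mainConjecture_iff_missingLowerBoundAt hW16 hGr hmod hGZK W p hX.two_ne
    hX.hasGoodReductionAtPrime hX.not_dvd_frobeniusTrace hX.not_hasIrreducibleModPGaloisRep hL]
  constructor
  · intro h
    exact ⟨fun _ ↦ h, fun h1 ↦ absurd (hr0.symm.trans h1) zero_ne_one⟩
  · intro h
    exact h.1 hr0

/-- **The class-level form.** Granted the same published facts: the rank-`0` class statement
"for every X1 pair with `ord_{s=1} L(E,s) = 0`, `BSD(E,p)`" holds IF AND ONLY IF Mazur's main
conjecture holds at every X1 pair of analytic rank `0` (all of parity type A). Neither side is in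
print; this records that nothing WEAKER than the main conjecture on that locus can delete
X1 ∩ {r = 0}, and nothing stronger is needed. [cite: GreenbergLNM1716, Thm. 4.1 and §5 (closing examples)]
[cite: Wuthrich2014, Thm. 16 (p. 393)] -/
theorem X1.forall_mainConjecture_iff_forall_bsdp (hW16 : charIdeal_dvd_padicLFunction)
    (hGr : greenberg_charValue_rankZero) (hmod : nonempty_modularParametrizationData)
    (hGZK : rank_eq_analyticRank_of_analyticRank_le_one) :
    (∀ (W : WeierstrassCurve ℚ) [W.IsElliptic] [W.IsGloballyMinimal] (p : ℕ) [Fact p.Prime],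
      ClassX1 W p → W.analyticRank = 0 →
      ∀ (κ : ZpExtension ℚ p) (γ : Field.absoluteGaloisGroup ℚ),
          κ.IsCyclotomic → κ.IsTopGenerator γ → IsCyclotomicVariable p γ →
        ∀ [NeZero (W.conductorNorm ℤ)] (f : CuspForm (Gamma0 (W.conductorNorm ℤ)) 2),
          IsNewformOf W f → ∀ (ϖ : ℚ), (ϖ : ℝ) * W.realPeriodRat = plusPeriod f →
        ∀ (D : W.SelmerDualData κ γ), D.IsTorsion ∧
          ∃ g : IwasawaAlgebra p, D.charIdeal = Ideal.span {g} ∧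
            iwasawaToPowerSeries p g =
              PowerSeries.C (ϖ : ℚ_[p]) * padicLFunction f (unitRoot W p : ℚ_[p])) ↔
    (∀ (W : WeierstrassCurve ℚ) [W.IsElliptic] [W.IsGloballyMinimal] (p : ℕ) [Fact p.Prime],
      ClassX1 W p → W.analyticRank = 0 → BSDp W p) := by
  constructor
  · intro h W _ _ p _ hX1 hr0
    exact (X1.mainConjecture_iff_bsdp hW16 hGr hmod hGZK W p hX1 hr0).mp (h W p hX1 hr0)
  · intro h W _ _ p _ hX1 hr0
    exact (X1.mainConjecture_iff_bsdp hW16 hGr hmod hGZK W p hX1 hr0).mpr (h W p hX1 hr0)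

/-- **Per-pair certificate: `p ∤ #Ш(E/ℚ)_an` ⟹ Mazur's main conjecture for `(E,p)`** at an X1 pair
with `L(E,1) ≠ 0`. Inputs by name: Wuthrich 2014 Prop. 21 (`hW`, gives `BSD(E,p)` on this sub-class:
`bsdp_of_classX1_of_L_one_ne_zero`), Thm. 16 (`hW16`), Greenberg Thm. 4.1 (`hGr`),
Gross–Zagier–Kolyvagin (`hGZK`); then the converse chain `mainConjecture_of_bsdp`. Examples (census
of the cell, all with `#Ш_an = 1`): `11a1@5` (Greenberg's `E_1`: `char X = (5)`, so the conclusion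
reads `(ϖ · L_5(f, α)) = (5)` in `Λ`), `14a1@3`, `26b1@7`. [cite: GreenbergLNM1716, §5 (Conductor = 11; Conductor = 26, p = 7)]
[cite: Wuthrich2014, Thm. 16 (p. 393) and Prop. 21 (p. 400)] -/
theorem X1.mainConjecture_of_shaAn_unit (hW : sha_dvd_analyticSha)
    (hW16 : charIdeal_dvd_padicLFunction) (hGr : greenberg_charValue_rankZero)
    (hGZK : rank_eq_analyticRank_of_analyticRank_le_one)
    (W : WeierstrassCurve ℚ) [W.IsElliptic] [W.IsGloballyMinimal] (p : ℕ) [Fact p.Prime]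
    (hX1 : ClassX1 W p) (hL : W.entireLFunction 1 ≠ 0)
    (hunit : ∃ q : ℚ, shaAn W = (q : ℂ) ∧ padicValRat p q = 0)
    {κ : ZpExtension ℚ p} {γ : Field.absoluteGaloisGroup ℚ} {N : ℕ} [NeZero N]
    {f : CuspForm (Gamma0 N) 2} (hκ : κ.IsCyclotomic) (hγ : κ.IsTopGenerator γ)
    (hγ' : IsCyclotomicVariable p γ) (hf : IsNewformOf W f) (D : W.SelmerDualData κ γ) (ϖ : ℚ)
    (hϖ : (ϖ : ℝ) * W.realPeriodRat = plusPeriod f) :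
    D.IsTorsion ∧ ∃ g : IwasawaAlgebra p, D.charIdeal = Ideal.span {g} ∧
      iwasawaToPowerSeries p g =
        PowerSeries.C ((ϖ : ℚ) : ℚ_[p]) * padicLFunction f (unitRoot W p : ℚ_[p]) := by
  have hX := isClassX1_of_classX1 hX1
  have hr : W.analyticRank ≤ 1 := by
    rw [analyticRank_eq_zero_of_entireLFunction_one_ne_zero W hL]; exact zero_le_one
  exact Wuthrich2014.mainConjecture_of_bsdp hW16 hGr hGZK W p hX.two_ne hX.hasGoodReductionAtPrime
    hX.not_dvd_frobeniusTrace hX.not_hasIrreducibleModPGaloisRep hL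
    (bsdp_of_classX1_of_L_one_ne_zero hW hGZK W p hr hX1 hL hunit) hκ hγ hγ' hf D ϖ hϖ

/-- **Per-pair certificate up to isogeny: `p ∤ #Ш(E'/ℚ)_an` for a `ℚ`-isogenous `E'` ⟹ Mazur's main
conjecture for `(E,p)`.** `(E,p)` an X1 pair with `L(E,1) ≠ 0`; `E' ∼ E` over `ℚ` (globally minimal
`W'`) with `p` an odd good anomalous Eisenstein prime of `E'` (`IsClassX1 W' p`, the superset predicate:
no parity clause) and `#Ш(E'/ℚ)_an` prime to `p`. Then `BSD(E,p)` (Prop. 21 for `E'` + Cassels'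
invariance `hCassels`, `bsdp_of_isClassX1_of_rank_zero_of_isIsogenous`) and hence, by the converse
chain, Mazur's main conjecture for `(E,p)` — consistent with "conjecture 1.13 is preserved by
`ℚ`-isogeny" (Greenberg LNM 1716 §5, Conductor = 34; Schneider / Perrin-Riou), which is not used.
Census examples: `2366d1@3`, `7154c1@3` (`#Ш_an = 9`) through `2366d2`, `7154c2` (`#Ш_an = 1`).
[cite: GreenbergLNM1716, §5 (Conductor = 34: isogeny invariance of conjecture 1.13)]
[cite: Wuthrich2014, Thm. 16 (p. 393) and Prop. 21 (p. 400)] [cite: MilneADT2006, Thm. I.7.3] -/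
theorem X1.mainConjecture_of_isIsogenous_of_shaAn_unit (hW : sha_dvd_analyticSha)
    (hW16 : charIdeal_dvd_padicLFunction) (hGr : greenberg_charValue_rankZero)
    (hGZK : rank_eq_analyticRank_of_analyticRank_le_one) (hCassels : bsdRHS_eq_of_isIsogenous)
    (W W' : WeierstrassCurve ℚ) [W.IsElliptic] [W'.IsElliptic] [W.IsGloballyMinimal]
    [W'.IsGloballyMinimal] (hiso : IsIsogenous W W') (p : ℕ) [Fact p.Prime]
    (hX1 : ClassX1 W p) (hX1' : IsClassX1 W' p) (hL : W.entireLFunction 1 ≠ 0)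
    (hunit' : ∃ q : ℚ, shaAn W' = (q : ℂ) ∧ padicValRat p q = 0)
    {κ : ZpExtension ℚ p} {γ : Field.absoluteGaloisGroup ℚ} {N : ℕ} [NeZero N]
    {f : CuspForm (Gamma0 N) 2} (hκ : κ.IsCyclotomic) (hγ : κ.IsTopGenerator γ)
    (hγ' : IsCyclotomicVariable p γ) (hf : IsNewformOf W f) (D : W.SelmerDualData κ γ) (ϖ : ℚ)
    (hϖ : (ϖ : ℝ) * W.realPeriodRat = plusPeriod f) :
    D.IsTorsion ∧ ∃ g : IwasawaAlgebra p, D.charIdeal = Ideal.span {g} ∧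
      iwasawaToPowerSeries p g =
        PowerSeries.C ((ϖ : ℚ) : ℚ_[p]) * padicLFunction f (unitRoot W p : ℚ_[p]) := by
  have hX := isClassX1_of_classX1 hX1
  exact Wuthrich2014.mainConjecture_of_bsdp hW16 hGr hGZK W p hX.two_ne hX.hasGoodReductionAtPrime
    hX.not_dvd_frobeniusTrace hX.not_hasIrreducibleModPGaloisRep hL
    (bsdp_of_isClassX1_of_rank_zero_of_isIsogenous hW hGZK hCassels W W' hiso p hX1' hL hunit')
    hκ hγ hγ' hf D ϖ hϖ

/-- **Per-pair certificate, general form: any proof of `BSD(E,p)` at a rank-`0` X1 pair gives Mazur's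
main conjecture for `(E,p)`** (e.g. from a published finite-conductor theorem, or from any future
certificate of `ord_p #Ш(E/ℚ) ≥ ord_p #Ш(E/ℚ)_an`). Facts: Wuthrich Thm. 16, Greenberg Thm. 4.1,
modularity, Gross–Zagier–Kolyvagin. [cite: GreenbergLNM1716, Thm. 4.1 and §5 (closing examples)]
[cite: Wuthrich2014, Thm. 16 (p. 393)] -/
theorem X1.mainConjecture_of_bsdp (hW16 : charIdeal_dvd_padicLFunction)
    (hGr : greenberg_charValue_rankZero) (hmod : nonempty_modularParametrizationData)
    (hGZK : rank_eq_analyticRank_of_analyticRank_le_one)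
    (W : WeierstrassCurve ℚ) [W.IsElliptic] [W.IsGloballyMinimal] (p : ℕ) [Fact p.Prime]
    (hX1 : ClassX1 W p) (hr0 : W.analyticRank = 0) (hbsd : BSDp W p)
    {κ : ZpExtension ℚ p} {γ : Field.absoluteGaloisGroup ℚ} {N : ℕ} [NeZero N]
    {f : CuspForm (Gamma0 N) 2} (hκ : κ.IsCyclotomic) (hγ : κ.IsTopGenerator γ)
    (hγ' : IsCyclotomicVariable p γ) (hf : IsNewformOf W f) (D : W.SelmerDualData κ γ) (ϖ : ℚ)
    (hϖ : (ϖ : ℝ) * W.realPeriodRat = plusPeriod f) :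
    D.IsTorsion ∧ ∃ g : IwasawaAlgebra p, D.charIdeal = Ideal.span {g} ∧
      iwasawaToPowerSeries p g =
        PowerSeries.C ((ϖ : ℚ) : ℚ_[p]) * padicLFunction f (unitRoot W p : ℚ_[p]) := by
  have hX := isClassX1_of_classX1 hX1
  exact Wuthrich2014.mainConjecture_of_bsdp hW16 hGr hGZK W p hX.two_ne hX.hasGoodReductionAtPrime
    hX.not_dvd_frobeniusTrace hX.not_hasIrreducibleModPGaloisRep
    (entireLFunction_one_ne_zero_of_analyticRank_eq_zero hmod W hr0) hbsd hκ hγ hγ' hf D ϖ hϖ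

/-! ### The finite sub-class in print: conductor `< 5000` (appended 2026-08-18, gen 2)

Miller 2011 Thm. 1.2, reducible case, completed by Creutz–Miller 2012 (tree fact
`bsdp_of_reducible_of_conductor_lt`, PUBLISHED, computer-assisted): `BSD(E,p)` for every `E/ℚ` with
`ord_{s=1} L(E,s) ≤ 1`, `N_E < 5000` and `E[p]` reducible. Composed with the converse chain
(`Wuthrich2014.mainConjecture_of_bsdp`): **Mazur's main conjecture is a theorem of the published
record at every reducible good ordinary odd prime `p` of every `E/ℚ` with `L(E,1) ≠ 0` and
`N_E < 5000`** — in particular at every rank-`0` X1 pair of conductor `< 5000` (Greenberg's examples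
`11a1@5`, `14a1@3`, `26b1@7` among them), with NO numerical hypothesis left in the statement (the
descents are inside the cited theorem). Inputs by name: Miller–Creutz–Miller (`hM`), Wuthrich 2014
Thm. 16 (`hW16`), Greenberg 1999 Thm. 4.1 (`hGr`), Gross–Zagier–Kolyvagin (`hGZK`). -/

/-- **Mazur's main conjecture for `(E,p)` at every reducible good ordinary odd `p`, for all `E/ℚ` with
`L(E,1) ≠ 0` and `N_E < 5000`** (every datum `(κ, γ, f, ϖ, D)`): Miller 2011 Thm. 1.2 / Creutz–Miller
2012 (`hM` = `bsdp_of_reducible_of_conductor_lt`) give `BSD(E,p)`; the converse chain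
(Wuthrich Thm. 16 `hW16` + Greenberg Thm. 4.1 `hGr`, with Gross–Zagier–Kolyvagin `hGZK`) turns it
into `char_Λ X(E/ℚ_∞) = (ϖ · L_p(f, α))`. [cite: Miller2011LMS, Thm. 1.2 (arXiv:1010.2431 p. 3)]
[cite: CreutzMiller2012, Thm. 1.1 and §7.1] [cite: GreenbergLNM1716, Thm. 4.1 and §5 (closing examples)]
[cite: Wuthrich2014, Thm. 16 (p. 393)] -/
theorem mainConjecture_of_conductor_lt (hM : bsdp_of_reducible_of_conductor_lt)
    (hW16 : charIdeal_dvd_padicLFunction) (hGr : greenberg_charValue_rankZero)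
    (hGZK : rank_eq_analyticRank_of_analyticRank_le_one)
    (W : WeierstrassCurve ℚ) [W.IsElliptic] [W.IsGloballyMinimal] (p : ℕ) [Fact p.Prime]
    (hp : p ≠ 2) (hgood : W.HasGoodReductionAtPrime p) (hord : ¬ (p : ℤ) ∣ W.frobeniusTrace p)
    (hred : ¬ W.HasIrreducibleModPGaloisRep p) (hL : W.entireLFunction 1 ≠ 0)
    (hN : W.conductorNorm ℤ < 5000)
    {κ : ZpExtension ℚ p} {γ : Field.absoluteGaloisGroup ℚ} {N : ℕ} [NeZero N]
    {f : CuspForm (Gamma0 N) 2} (hκ : κ.IsCyclotomic) (hγ : κ.IsTopGenerator γ)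
    (hγ' : IsCyclotomicVariable p γ) (hf : IsNewformOf W f) (D : W.SelmerDualData κ γ) (ϖ : ℚ)
    (hϖ : (ϖ : ℝ) * W.realPeriodRat = plusPeriod f) :
    D.IsTorsion ∧ ∃ g : IwasawaAlgebra p, D.charIdeal = Ideal.span {g} ∧
      iwasawaToPowerSeries p g =
        PowerSeries.C ((ϖ : ℚ) : ℚ_[p]) * padicLFunction f (unitRoot W p : ℚ_[p]) := by
  have hr : W.analyticRank ≤ 1 := by
    rw [analyticRank_eq_zero_of_entireLFunction_one_ne_zero W hL]; exact zero_le_one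
  exact Wuthrich2014.mainConjecture_of_bsdp hW16 hGr hGZK W p hp hgood hord hred hL
    (hM W hr hN p Fact.out hred) hκ hγ hγ' hf D ϖ hϖ

/-- **X1 pairs of conductor `< 5000`, analytic rank `0`: Mazur's main conjecture for `(E,p)`**
(class-level on the finite sub-class `N_E < 5000`; same inputs, `ClassX1 W p` supplies odd / good /
ordinary-by-anomaly / reducible). [cite: Miller2011LMS, Thm. 1.2 (arXiv:1010.2431 p. 3)]
[cite: CreutzMiller2012, Thm. 1.1 and §7.1] [cite: GreenbergLNM1716, §5 (Conductor = 11, 14, 26)] -/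
theorem X1.mainConjecture_of_conductor_lt (hM : bsdp_of_reducible_of_conductor_lt)
    (hW16 : charIdeal_dvd_padicLFunction) (hGr : greenberg_charValue_rankZero)
    (hGZK : rank_eq_analyticRank_of_analyticRank_le_one)
    (W : WeierstrassCurve ℚ) [W.IsElliptic] [W.IsGloballyMinimal] (p : ℕ) [Fact p.Prime]
    (hX1 : ClassX1 W p) (hL : W.entireLFunction 1 ≠ 0) (hN : W.conductorNorm ℤ < 5000)
    {κ : ZpExtension ℚ p} {γ : Field.absoluteGaloisGroup ℚ} {N : ℕ} [NeZero N]
    {f : CuspForm (Gamma0 N) 2} (hκ : κ.IsCyclotomic) (hγ : κ.IsTopGenerator γ)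
    (hγ' : IsCyclotomicVariable p γ) (hf : IsNewformOf W f) (D : W.SelmerDualData κ γ) (ϖ : ℚ)
    (hϖ : (ϖ : ℝ) * W.realPeriodRat = plusPeriod f) :
    D.IsTorsion ∧ ∃ g : IwasawaAlgebra p, D.charIdeal = Ideal.span {g} ∧
      iwasawaToPowerSeries p g =
        PowerSeries.C ((ϖ : ℚ) : ℚ_[p]) * padicLFunction f (unitRoot W p : ℚ_[p]) := by
  have hX := isClassX1_of_classX1 hX1
  exact Rank1Residual.mainConjecture_of_conductor_lt hM hW16 hGr hGZK W p hX.two_ne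
    hX.hasGoodReductionAtPrime hX.not_dvd_frobeniusTrace hX.not_hasIrreducibleModPGaloisRep hL hN hκ hγ
    hγ' hf D ϖ hϖ

end Literature.NumberTheory.EllipticCurves.Rank1Residual

end
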